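import Summits.Ventures.DiscreteObjects.UnitDistance.Sqrt2Sqrt3Local
import Summits.Ventures.DiscreteObjects.UnitDistance.MoserMultiquadratic
import Summits.Ventures.DiscreteObjects.UnitDistance.FourChromaticSqrt2Sqrt3

/-!
# U4 in the kernel: `χ(ℚ(√2,√3)²) = 4` (cell `pub-namedobj`, target (U), seat udg g10)

Framing (verbatim for the cell): lottery ticket; floor = certified bounds/negative ranges.

Every unit-distance graph with all coordinates in the real biquadratic field `ℚ(√2, √3)` is `4`-colourable; with the
10-vertex 4-chromatic graph of `FourChromaticSqrt2Sqrt3` (VND 2022 `L₁₀`), `χ(ℚ(√2,√3)²) = 4`.  This is the cell's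
by-product theorem U4 (udg g3 TABLE-U3 / Prop U2, 2026-08-20; its field is NOT covered by `MoserMultiquadratic`:
`2 ∉ {1, 3} mod 8`), now hypothesis-free in the kernel.  Route: as for U1 (`MoserFieldPlane`) with the local field
`ℚ₂(√2, √3, i) = ℚ₂(ζ₂₄)`; the residue bound comes from `Zeta8Residues` (totally ramified `ℚ₂(ζ₈)`, dimension count)
instead of the `ℤ₂[i]`-lemma.  The three Galois elements exist because `±1·2, ±2·3, 3, −1, −3, −1/3, −2/3` are
non-squares in `ℚ₂`.  Nothing here is literature.
-/

noncomputable section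

namespace Summit.Ventures.DiscreteObjects.UnitDistance

open MoserLocal SimpleGraph IntermediateField
open scoped IntermediateField

/-! ## Non-squares in `ℚ₂` -/

/-- An element of norm `1/2` is not a square in `ℚ₂` (odd valuation). -/
theorem TwoAdic.sq_ne_of_norm_eq_half {c : ℚ_[2]} (hc : ‖c‖ = 2⁻¹) (q : ℚ_[2]) : q ^ 2 ≠ c := by
  intro h
  have hq : q ≠ 0 := by rintro rfl; rw [zero_pow two_ne_zero] at h; rw [← h, norm_zero] at hc; norm_num at hc
  obtain ⟨a, ha⟩ := exists_norm_eq_zpow hq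
  have : ‖c‖ = (2 : ℝ) ^ (2 * a) := by rw [← h, norm_pow, ha, ← zpow_natCast, ← zpow_mul, mul_comm]; norm_num
  rw [hc, ← zpow_neg_one] at this
  have := zpow_right_injective₀ (by norm_num : (0 : ℝ) < 2) (by norm_num : (2 : ℝ) ≠ 1) this
  omega

/-- `2, -2, 6, -6, -2/3` have norm `1/2` (and `‖3‖₂ = 1`). -/
theorem TwoAdic.norm_eq_half_cases :
    ‖(2 : ℚ_[2])‖ = 2⁻¹ ∧ ‖(-2 : ℚ_[2])‖ = 2⁻¹ ∧ ‖(6 : ℚ_[2])‖ = 2⁻¹ ∧ ‖(-6 : ℚ_[2])‖ = 2⁻¹ ∧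
      ‖(-2 / 3 : ℚ_[2])‖ = 2⁻¹ := by
  have h2 : ‖(2 : ℚ_[2])‖ = 2⁻¹ := by simpa using Padic.norm_p (p := 2)
  have h3 : ‖(3 : ℚ_[2])‖ = 1 := by
    have h := Padic.norm_int_le_one (p := 2) 3
    have h' : ¬ ‖((3 : ℤ) : ℚ_[2])‖ < 1 := by
      rw [Padic.norm_intCast_lt_one_iff]; decide
    push_cast at h h'
    exact le_antisymm h (not_lt.1 h')
  refine ⟨h2, by rw [norm_neg, h2], ?_, ?_, ?_⟩
  · rw [show (6 : ℚ_[2]) = 2 * 3 by norm_num, norm_mul, h2, h3, mul_one]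
  · rw [norm_neg, show (6 : ℚ_[2]) = 2 * 3 by norm_num, norm_mul, h2, h3, mul_one]
  · rw [norm_div, norm_neg, h2, h3, div_one]

/-- `-1/3` is not a square in `ℚ₂`. -/
theorem TwoAdic.sq_ne_neg_third (q : ℚ_[2]) : q ^ 2 ≠ -1 / 3 := by
  intro h
  have : (3 * q) ^ 2 = -3 := by rw [mul_pow, h]; norm_num
  exact TwoAdic.sq_ne_neg_three _ this

/-! ## Non-squares in quadratic and biquadratic subfields of `Ω₂` -/

/-- ONE LEVEL: if `s² = m` and `m, c, c·m` are non-squares in `ℚ₂`, then no element of `ℚ₂(s)` squares to `c`. -/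
theorem sq_ne_of_mem_adjoin_root {s : Ω₂} {m c : ℚ_[2]} (hs : s ^ 2 = algebraMap ℚ_[2] Ω₂ m)
    (hm : ∀ q : ℚ_[2], q ^ 2 ≠ m) (hc : ∀ q : ℚ_[2], q ^ 2 ≠ c) (hcm : ∀ q : ℚ_[2], q ^ 2 ≠ c * m) :
    ∀ e ∈ ℚ_[2]⟮s⟯, e ^ 2 ≠ algebraMap ℚ_[2] Ω₂ c := by
  intro e he h
  obtain ⟨α, β, rfl⟩ := exists_coeffs_of_mem_adjoin_simple hs he
  have key : algebraMap ℚ_[2] Ω₂ (α ^ 2 + m * β ^ 2 - c) + algebraMap ℚ_[2] Ω₂ (2 * α * β) * s = 0 := by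
    simp only [map_add, map_sub, map_mul, map_pow, map_ofNat]
    linear_combination h - (algebraMap ℚ_[2] Ω₂ β) ^ 2 * hs
  by_cases hab : 2 * α * β = 0
  · rw [hab, map_zero, zero_mul, add_zero, map_eq_zero] at key
    rcases mul_eq_zero.1 hab with h2a | hb
    · have ha : α = 0 := by simpa using h2a
      rw [ha] at key
      apply hcm (m * β)
      linear_combination m * key
    · rw [hb] at key
      apply hc α
      linear_combination key
  · have hsQ : s = algebraMap ℚ_[2] Ω₂ (-(α ^ 2 + m * β ^ 2 - c) / (2 * α * β)) := by
      rw [map_div₀, map_neg, eq_div_iff ((_root_.map_ne_zero _).2 hab)]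
      linear_combination key
    apply hm (-(α ^ 2 + m * β ^ 2 - c) / (2 * α * β))
    have h1 := hs
    rw [hsQ, ← map_pow] at h1
    exact (algebraMap ℚ_[2] Ω₂).injective h1

/-- TWO LEVELS: with `t² = n` (`n ≠ 0`), if no element of `ℚ₂(s)` squares to `n`, to `c`, or to `c/n`,
then no element of `ℚ₂(s, t)` squares to `c`. -/
theorem sq_ne_of_mem_adjoin_two {s t : Ω₂} {n c : ℚ_[2]}
    (ht : t ^ 2 = algebraMap ℚ_[2] Ω₂ n) (hn : n ≠ 0)
    (h1 : ∀ e ∈ ℚ_[2]⟮s⟯, e ^ 2 ≠ algebraMap ℚ_[2] Ω₂ n) (h2 : ∀ e ∈ ℚ_[2]⟮s⟯, e ^ 2 ≠ algebraMap ℚ_[2] Ω₂ c)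
    (h3 : ∀ e ∈ ℚ_[2]⟮s⟯, e ^ 2 ≠ algebraMap ℚ_[2] Ω₂ (c / n)) :
    ∀ e ∈ ℚ_[2]⟮s, t⟯, e ^ 2 ≠ algebraMap ℚ_[2] Ω₂ c := by
  intro e he h
  -- view `e` in the tower `ℚ₂(s)(t)`
  set F := ℚ_[2]⟮s⟯ with hF
  have he' : e ∈ F⟮t⟯ := by
    have : e ∈ (F⟮t⟯).restrictScalars ℚ_[2] := by rw [adjoin_simple_adjoin_simple]; exact he
    exact this
  have htF : t ^ 2 = algebraMap F Ω₂ ⟨algebraMap ℚ_[2] Ω₂ n, IntermediateField.algebraMap_mem _ n⟩ := by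
    rw [ht]; rfl
  obtain ⟨A, B, hAB⟩ := exists_coeffs_of_mem_adjoin_simple htF he'
  have hA : (algebraMap F Ω₂ A) = (A : Ω₂) := rfl
  have hB : (algebraMap F Ω₂ B) = (B : Ω₂) := rfl
  rw [hA, hB] at hAB
  rw [hAB] at h
  -- (A + B t)² = A² + n B² + 2AB t = c
  have key : ((A : Ω₂) ^ 2 + algebraMap ℚ_[2] Ω₂ n * (B : Ω₂) ^ 2 - algebraMap ℚ_[2] Ω₂ c) +
      (2 * (A : Ω₂) * B) * t = 0 := by
    linear_combination h - (B : Ω₂) ^ 2 * ht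
  by_cases hab : (2 * (A : Ω₂) * B) = 0
  · rw [hab, zero_mul, add_zero] at key
    have htwo : (2 : Ω₂) ≠ 0 := two_ne_zero
    rcases mul_eq_zero.1 hab with h2a | hb
    · rcases mul_eq_zero.1 h2a with h22 | ha
      · exact htwo h22
      · -- A = 0: n B² = c, so B² = c/n with B ∈ ℚ₂(s)
        rw [ha] at key
        apply h3 B B.2
        rw [map_div₀, eq_div_iff ((_root_.map_ne_zero _).2 hn)]
        linear_combination key
    · rw [hb] at key
      apply h2 A A.2
      linear_combination key
  · -- t ∈ ℚ₂(s)
    have htF' : t = -(((A : Ω₂) ^ 2 + algebraMap ℚ_[2] Ω₂ n * (B : Ω₂) ^ 2 - algebraMap ℚ_[2] Ω₂ c)) /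
        (2 * (A : Ω₂) * B) := by
      rw [eq_div_iff hab]; linear_combination key
    have htmem : t ∈ ℚ_[2]⟮s⟯ := by
      rw [htF']
      refine div_mem (neg_mem (sub_mem (add_mem (pow_mem A.2 2) (mul_mem (IntermediateField.algebraMap_mem _ n)
        (pow_mem B.2 2))) (IntermediateField.algebraMap_mem _ c))) ?_
      exact mul_mem (mul_mem (by exact_mod_cast (IntermediateField.algebraMap_mem ℚ_[2]⟮s⟯ (2 : ℚ_[2]))) A.2) B.2
    exact h1 t htmem ht

/-! ## The local data for `ℚ(√2, √3)` exist in `Ω₂` -/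

/-- `ℚ₂(s2)`-level facts: no element squares to `-1`, `3`, `-3`, `-1/3`. -/
theorem sq_ne_of_mem_adjoin_sqrt2 {s2 : Ω₂} (hs2 : s2 ^ 2 = 2) :
    (∀ e ∈ ℚ_[2]⟮s2⟯, e ^ 2 ≠ algebraMap ℚ_[2] Ω₂ (-1)) ∧ (∀ e ∈ ℚ_[2]⟮s2⟯, e ^ 2 ≠ algebraMap ℚ_[2] Ω₂ 3) ∧
      (∀ e ∈ ℚ_[2]⟮s2⟯, e ^ 2 ≠ algebraMap ℚ_[2] Ω₂ (-3)) ∧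
      (∀ e ∈ ℚ_[2]⟮s2⟯, e ^ 2 ≠ algebraMap ℚ_[2] Ω₂ (-1 / 3)) := by
  obtain ⟨n2, nm2, n6, nm6, nm23⟩ := TwoAdic.norm_eq_half_cases
  have hs2' : s2 ^ 2 = algebraMap ℚ_[2] Ω₂ 2 := by rw [hs2, map_ofNat]
  have two_ns := TwoAdic.sq_ne_of_norm_eq_half n2
  refine ⟨?_, ?_, ?_, ?_⟩
  · exact sq_ne_of_mem_adjoin_root hs2' two_ns TwoAdic.sq_ne_neg_one
      (fun q => by rw [show (-1 : ℚ_[2]) * 2 = -2 by norm_num]; exact TwoAdic.sq_ne_of_norm_eq_half nm2 q)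
  · exact sq_ne_of_mem_adjoin_root hs2' two_ns TwoAdic.sq_ne_three
      (fun q => by rw [show (3 : ℚ_[2]) * 2 = 6 by norm_num]; exact TwoAdic.sq_ne_of_norm_eq_half n6 q)
  · exact sq_ne_of_mem_adjoin_root hs2' two_ns TwoAdic.sq_ne_neg_three
      (fun q => by rw [show (-3 : ℚ_[2]) * 2 = -6 by norm_num]; exact TwoAdic.sq_ne_of_norm_eq_half nm6 q)
  · exact sq_ne_of_mem_adjoin_root hs2' two_ns TwoAdic.sq_ne_neg_third
      (fun q => by rw [show (-1 / 3 : ℚ_[2]) * 2 = -2 / 3 by norm_num]; exact TwoAdic.sq_ne_of_norm_eq_half nm23 q)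

/-- THE LOCAL DATA EXIST: `I, s2, s3 ∈ Ω₂` with the three automorphisms `σ, τ, ρ`. -/
theorem nonempty_localData23 : Nonempty (LocalData23 Ω₂) := by
  obtain ⟨I, hI⟩ := IsAlgClosed.exists_pow_nat_eq (-1 : Ω₂) two_pos
  obtain ⟨s2, hs2⟩ := IsAlgClosed.exists_pow_nat_eq (2 : Ω₂) two_pos
  obtain ⟨s3, hs3⟩ := IsAlgClosed.exists_pow_nat_eq (3 : Ω₂) two_pos
  have hI' : I ^ 2 = algebraMap ℚ_[2] Ω₂ (-1) := by rw [hI, map_neg, map_one]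
  have hs2' : s2 ^ 2 = algebraMap ℚ_[2] Ω₂ 2 := by rw [hs2, map_ofNat]
  have hs3' : s3 ^ 2 = algebraMap ℚ_[2] Ω₂ 3 := by rw [hs3, map_ofNat]
  obtain ⟨f1, f3, fm3, fm13⟩ := sq_ne_of_mem_adjoin_sqrt2 hs2
  -- σ : negate I over ℚ₂(s2, s3)
  have hσE : ∀ e ∈ ℚ_[2]⟮s2, s3⟯, e ^ 2 ≠ algebraMap ℚ_[2] Ω₂ (-1) :=
    sq_ne_of_mem_adjoin_two hs3' (by norm_num) f3 f1
      (fun e he => by rw [show (-1 : ℚ_[2]) / 3 = -1 / 3 by norm_num]; exact fm13 e he)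
  obtain ⟨σ, hσI, hσE'⟩ := exists_aut_neg ℚ_[2]⟮s2, s3⟯ hI' hσE
  -- τ : negate s3 over ℚ₂(s2, I)
  have hτE : ∀ e ∈ ℚ_[2]⟮s2, I⟯, e ^ 2 ≠ algebraMap ℚ_[2] Ω₂ 3 :=
    sq_ne_of_mem_adjoin_two hI' (by norm_num) f1 f3
      (fun e he => by rw [show (3 : ℚ_[2]) / -1 = -3 by norm_num]; exact fm3 e he)
  obtain ⟨τ, hτs3, hτE'⟩ := exists_aut_neg ℚ_[2]⟮s2, I⟯ hs3' hτE
  -- ρ : negate s2 over ℚ₂(I)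
  obtain ⟨n2, nm2, -, -, -⟩ := TwoAdic.norm_eq_half_cases
  have hρE : ∀ e ∈ ℚ_[2]⟮I⟯, e ^ 2 ≠ algebraMap ℚ_[2] Ω₂ 2 :=
    sq_ne_of_mem_adjoin_root hI' TwoAdic.sq_ne_neg_one (TwoAdic.sq_ne_of_norm_eq_half n2)
      (fun q => by rw [show (2 : ℚ_[2]) * -1 = -2 by norm_num]; exact TwoAdic.sq_ne_of_norm_eq_half nm2 q)
  obtain ⟨ρ, hρs2, hρE'⟩ := exists_aut_neg ℚ_[2]⟮I⟯ hs2' hρE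
  have m2 : s2 ∈ ℚ_[2]⟮s2, s3⟯ := subset_adjoin _ _ (by simp)
  have m3 : s3 ∈ ℚ_[2]⟮s2, s3⟯ := subset_adjoin _ _ (by simp)
  have m2' : s2 ∈ ℚ_[2]⟮s2, I⟯ := subset_adjoin _ _ (by simp)
  have mI' : I ∈ ℚ_[2]⟮s2, I⟯ := subset_adjoin _ _ (by simp)
  exact ⟨⟨I, s2, s3, hI, hs2, hs3, σ, τ, ρ, hσI, hσE' s2 m2, hσE' s3 m3, hτE' I mI', hτE' s2 m2', hτs3,
    hρE' I (mem_adjoin_simple_self _ I), hρs2⟩⟩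

/-- A fixed choice of local data for `ℚ(√2, √3)`. -/
def localData23 : LocalData23 Ω₂ := Classical.choice nonempty_localData23

/-! ## The real side: `ℚ(√2, √3) = multiSqrtField {2, 3}` and its embedding -/

/-- `K = ℚ(√2, √3) ⊂ ℝ`, as the multiquadratic field of `MoserMultiquadratic`. -/
abbrev sqrt2sqrt3Field : IntermediateField ℚ ℝ := multiSqrtField {2, 3}

/-- Four-coefficient form of the elements of `ℚ₂(s2, s3) ⊂ Ω₂`. -/
theorem exists_coeffs_of_mem_adjoin_sqrt2_sqrt3 (D : LocalData23 Ω₂) {e : Ω₂} (he : e ∈ ℚ_[2]⟮D.s2, D.s3⟯) :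
    ∃ a b c d : ℚ_[2], e = (algebraMap ℚ_[2] Ω₂ a + algebraMap ℚ_[2] Ω₂ b * D.s2) +
      (algebraMap ℚ_[2] Ω₂ c + algebraMap ℚ_[2] Ω₂ d * D.s2) * D.s3 := by
  set F := ℚ_[2]⟮D.s2⟯ with hF
  have he' : e ∈ F⟮D.s3⟯ := by
    have : e ∈ (F⟮D.s3⟯).restrictScalars ℚ_[2] := by rw [adjoin_simple_adjoin_simple]; exact he
    exact this
  have htF : D.s3 ^ 2 = algebraMap F Ω₂ ⟨algebraMap ℚ_[2] Ω₂ 3, IntermediateField.algebraMap_mem _ 3⟩ := by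
    rw [D.hs3]; change (3 : Ω₂) = algebraMap ℚ_[2] Ω₂ 3; rw [map_ofNat]
  obtain ⟨A, B, hAB⟩ := exists_coeffs_of_mem_adjoin_simple htF he'
  have hs2 : D.s2 ^ 2 = algebraMap ℚ_[2] Ω₂ 2 := by rw [D.hs2, map_ofNat]
  obtain ⟨a, b, hA⟩ := exists_coeffs_of_mem_adjoin_simple hs2 A.2
  obtain ⟨c, d, hB⟩ := exists_coeffs_of_mem_adjoin_simple hs2 B.2
  refine ⟨a, b, c, d, ?_⟩
  rw [hAB]
  change (A : Ω₂) + (B : Ω₂) * D.s3 = _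
  rw [hA, hB]

/-- IMAGE LEMMA: the embedding of `ℚ(√2, √3)` lands in `ℚ₂(s2, s3)`. -/
theorem sqrt2sqrt3Embed_mem (D : LocalData23 Ω₂) (t : sqrt2sqrt3Field) :
    multiSqrtEmbed {2, 3} t ∈ ℚ_[2]⟮D.s2, D.s3⟯ := by
  obtain ⟨t, ht⟩ := t
  induction ht using IntermediateField.adjoin_induction with
  | mem y hy =>
    obtain ⟨d, hdS, rfl⟩ := hy
    have hdS' : d = 2 ∨ d = 3 := by simpa using hdS
    have hmem : Real.sqrt d ∈ multiSqrtField {2, 3} := IntermediateField.subset_adjoin ℚ _ ⟨d, hdS, rfl⟩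
    have hsq : (multiSqrtEmbed {2, 3} ⟨Real.sqrt d, hmem⟩) ^ 2 = (d : Ω₂) := by
      have hK : (⟨Real.sqrt d, hmem⟩ : multiSqrtField {2, 3}) ^ 2 = d := by
        apply Subtype.ext
        simp [Real.sq_sqrt (Nat.cast_nonneg d)]
      rw [← map_pow, hK, map_natCast]
    rcases hdS' with rfl | rfl
    · have h : (multiSqrtEmbed {2, 3} ⟨Real.sqrt (2 : ℕ), hmem⟩) ^ 2 = D.s2 ^ 2 := by
        rw [hsq, D.hs2]; norm_num
      rcases sq_eq_sq_iff_eq_or_eq_neg.1 h with h' | h'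
      · rw [h']; exact subset_adjoin _ _ (by simp)
      · rw [h']; exact neg_mem (subset_adjoin _ _ (by simp))
    · have h : (multiSqrtEmbed {2, 3} ⟨Real.sqrt (3 : ℕ), hmem⟩) ^ 2 = D.s3 ^ 2 := by
        rw [hsq, D.hs3]; norm_num
      rcases sq_eq_sq_iff_eq_or_eq_neg.1 h with h' | h'
      · rw [h']; exact subset_adjoin _ _ (by simp)
      · rw [h']; exact neg_mem (subset_adjoin _ _ (by simp))
  | algebraMap q =>
    have : (⟨algebraMap ℚ ℝ q, IntermediateField.algebraMap_mem _ q⟩ : multiSqrtField {2, 3}) =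
        algebraMap ℚ (multiSqrtField {2, 3}) q := Subtype.ext rfl
    rw [this, (multiSqrtEmbed {2, 3}).commutes, algebraMap_rat_eq]
    exact IntermediateField.algebraMap_mem _ _
  | add y w hy hw ihy ihw =>
    have : (⟨y + w, add_mem hy hw⟩ : multiSqrtField {2, 3}) = ⟨y, hy⟩ + ⟨w, hw⟩ := rfl
    rw [this, map_add]; exact add_mem ihy ihw
  | inv y hy ihy =>
    have : (⟨y⁻¹, inv_mem hy⟩ : multiSqrtField {2, 3}) = ⟨y, hy⟩⁻¹ := rfl
    rw [this, map_inv₀]; exact inv_mem ihy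
  | mul y w hy hw ihy ihw =>
    have : (⟨y * w, mul_mem hy hw⟩ : multiSqrtField {2, 3}) = ⟨y, hy⟩ * ⟨w, hw⟩ := rfl
    rw [this, map_mul]; exact mul_mem ihy ihw

/-! ## THEOREM U4 -/

/-- THEOREM U4 (core form): a graph with vertex coordinates `x v, y v ∈ ℚ(√2, √3)` and
`(x v − x w)² + (y v − y w)² = 1` on every edge is `4`-colourable. -/
theorem colorable_four_of_sqrt2sqrt3Field {V : Type*} {G : SimpleGraph V} (x y : V → sqrt2sqrt3Field)
    (hadj : ∀ ⦃v w : V⦄, G.Adj v w → (x v - x w) ^ 2 + (y v - y w) ^ 2 = 1) : G.Colorable 4 := by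
  set D := localData23 with hD
  set φ : sqrt2sqrt3Field →ₐ[ℚ] Ω₂ := multiSqrtEmbed {2, 3} with hφ
  let z : V → Ω₂ := fun v => φ (x v) + D.I * φ (y v)
  apply colorable_four_of_unitStep23_labels D z
  intro v w hvw
  obtain ⟨a, b, c, d, hX⟩ := exists_coeffs_of_mem_adjoin_sqrt2_sqrt3 D (sqrt2sqrt3Embed_mem D (x v - x w))
  obtain ⟨e, f, g, h, hY⟩ := exists_coeffs_of_mem_adjoin_sqrt2_sqrt3 D (sqrt2sqrt3Embed_mem D (y v - y w))
  refine ⟨a, b, c, d, e, f, g, h, ?_, ?_⟩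
  · change (φ (x v) + D.I * φ (y v)) - (φ (x w) + D.I * φ (y w)) = _
    rw [← hX, ← hY, map_sub, map_sub]; ring
  · rw [← hX, ← hY, ← map_pow, ← map_pow, ← map_add, hadj hvw, map_one]

/-- THEOREM U4 for unit-distance realisations: all coordinates in `ℚ(√2, √3)` ⇒ `4`-colourable. -/
theorem colorable_four_of_realisation_in_sqrt2sqrt3Field {V : Type*} {G : SimpleGraph V}
    {p : V → EuclideanSpace ℝ (Fin 2)} (hp : IsUnitDistanceRealisation G p)
    (hK : ∀ v i, p v i ∈ sqrt2sqrt3Field) : G.Colorable 4 := by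
  refine colorable_four_of_sqrt2sqrt3Field (G := G) (fun v => ⟨p v 0, hK v 0⟩) (fun v => ⟨p v 1, hK v 1⟩) ?_
  intro v w hvw
  apply Subtype.ext
  push_cast
  exact sq_add_sq_eq_one_of_dist_eq_one (hp.2 hvw)

/-- Every `a + b√2 + c√3 + d√2√3` (`a b c d ∈ ℚ`) lies in `ℚ(√2, √3)`. -/
theorem combo_mem_sqrt2sqrt3 (a b c d : ℚ) :
    (a : ℝ) + b * Real.sqrt 2 + c * Real.sqrt 3 + d * (Real.sqrt 2 * Real.sqrt 3) ∈ sqrt2sqrt3Field := by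
  have hq : ∀ q : ℚ, (q : ℝ) ∈ sqrt2sqrt3Field := fun q => IntermediateField.algebraMap_mem sqrt2sqrt3Field q
  have h2 : Real.sqrt 2 ∈ sqrt2sqrt3Field := by
    simpa using sqrt_mem_multiSqrtField (S := {2, 3}) (d := 2) (by simp)
  have h3 : Real.sqrt 3 ∈ sqrt2sqrt3Field := by
    simpa using sqrt_mem_multiSqrtField (S := {2, 3}) (d := 3) (by simp)
  exact add_mem (add_mem (add_mem (hq a) (mul_mem (hq b) h2)) (mul_mem (hq c) h3)) (mul_mem (hq d) (mul_mem h2 h3))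

/-- The twenty coordinates of `L₁₀` (`FourChromaticSqrt2Sqrt3.pt`) lie in `ℚ(√2, √3)`. -/
theorem l10_pt_mem (i : Fin 10) : (VNDL10.pt i).1 ∈ sqrt2sqrt3Field ∧ (VNDL10.pt i).2 ∈ sqrt2sqrt3Field := by
  fin_cases i
  · exact ⟨by convert combo_mem_sqrt2sqrt3 (-1/2) (1/4) (-1/3) (1/12) using 1; simp [VNDL10.pt]; ring,
      by convert combo_mem_sqrt2sqrt3 0 (-1/4) (-1/6) (1/12) using 1; simp [VNDL10.pt]; ring⟩
  · exact ⟨by convert combo_mem_sqrt2sqrt3 (-1/2) (1/4) 0 (1/4) using 1; simp [VNDL10.pt]; ring,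
      by convert combo_mem_sqrt2sqrt3 0 (-1/4) (-1/2) (1/4) using 1; simp [VNDL10.pt]; ring⟩
  · exact ⟨by convert combo_mem_sqrt2sqrt3 (-1/2) 0 (-1/3) (1/6) using 1; simp [VNDL10.pt]; ring,
      by convert combo_mem_sqrt2sqrt3 0 0 (-1/6) (1/6) using 1; simp [VNDL10.pt]; ring⟩
  · exact ⟨by convert combo_mem_sqrt2sqrt3 (-1/2) 0 0 0 using 1; simp [VNDL10.pt],
      by convert combo_mem_sqrt2sqrt3 0 0 (-1/2) 0 using 1; simp [VNDL10.pt]⟩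
  · exact ⟨by convert combo_mem_sqrt2sqrt3 0 (1/4) (-1/2) (1/4) using 1; simp [VNDL10.pt]; ring,
      by convert combo_mem_sqrt2sqrt3 (1/2) (-1/4) 0 (1/4) using 1; simp [VNDL10.pt]; ring⟩
  · exact ⟨by convert combo_mem_sqrt2sqrt3 0 (1/4) (-1/6) (1/12) using 1; simp [VNDL10.pt]; ring,
      by convert combo_mem_sqrt2sqrt3 (1/2) (-1/4) (-1/3) (1/12) using 1; simp [VNDL10.pt]; ring⟩
  · exact ⟨by convert combo_mem_sqrt2sqrt3 0 (1/4) 0 (1/4) using 1; simp [VNDL10.pt]; ring,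
      by convert combo_mem_sqrt2sqrt3 0 (-1/4) 0 (1/4) using 1; simp [VNDL10.pt]; ring⟩
  · exact ⟨by convert combo_mem_sqrt2sqrt3 0 0 (-1/2) 0 using 1; simp [VNDL10.pt],
      by convert combo_mem_sqrt2sqrt3 (1/2) 0 0 0 using 1; simp [VNDL10.pt]⟩
  · exact ⟨by convert combo_mem_sqrt2sqrt3 0 0 (-1/6) (1/6) using 1; simp [VNDL10.pt]; ring,
      by convert combo_mem_sqrt2sqrt3 (1/2) 0 (-1/3) (1/6) using 1; simp [VNDL10.pt]; ring⟩
  · exact ⟨by convert combo_mem_sqrt2sqrt3 0 0 0 0 using 1; simp [VNDL10.pt],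
      by convert combo_mem_sqrt2sqrt3 0 0 0 0 using 1; simp [VNDL10.pt]⟩

/-- `L₁₀` with `K`-valued coordinates maps into `unitCircleGraph K`. -/
def l10HomK : VNDL10.l10 →g unitCircleGraph sqrt2sqrt3Field where
  toFun i := (⟨(VNDL10.pt i).1, (l10_pt_mem i).1⟩, ⟨(VNDL10.pt i).2, (l10_pt_mem i).2⟩)
  map_rel' := by
    intro i j hij
    have hsq : ((⟨(VNDL10.pt i).1, (l10_pt_mem i).1⟩ : sqrt2sqrt3Field) - ⟨(VNDL10.pt j).1, (l10_pt_mem j).1⟩) ^ 2 +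
        ((⟨(VNDL10.pt i).2, (l10_pt_mem i).2⟩ : sqrt2sqrt3Field) - ⟨(VNDL10.pt j).2, (l10_pt_mem j).2⟩) ^ 2 = 1 := by
      apply Subtype.ext
      push_cast
      have := VNDL10.adj_sqDist_eq_one hij
      simpa [VNDL10.sqDist] using this
    exact ⟨ne_of_sq_add_sq_eq_one hsq, hsq⟩

/-- THEOREM U4 (algebraic form): `χ(ℚ(√2,√3)²) = 4` — the unit-quadrance graph of `ℚ(√2, √3)` has chromatic number `4`. -/
theorem chromaticNumber_unitCircleGraph_sqrt2sqrt3 :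
    (unitCircleGraph sqrt2sqrt3Field).chromaticNumber = 4 := by
  rw [show (4 : ℕ∞) = (3 : ℕ) + 1 by norm_num]
  refine chromaticNumber_eq_iff_colorable_not_colorable.mpr ⟨?_, fun h => VNDL10.not_colorable_three (h.of_hom l10HomK)⟩
  exact colorable_four_of_sqrt2sqrt3Field (G := unitCircleGraph sqrt2sqrt3Field) Prod.fst Prod.snd fun _ _ h => h.2

/-- The points of the Euclidean plane with both coordinates in `ℚ(√2, √3)`. -/
def sqrt2sqrt3Points : Set (EuclideanSpace ℝ (Fin 2)) := {q | ∀ i, q i ∈ sqrt2sqrt3Field}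

/-- `L₁₀` as points of `ℚ(√2,√3)² ⊂ ℝ²`, a homomorphism into the restricted plane graph. -/
def l10HomPlane : VNDL10.l10 →g planeUnitDistanceGraph.induce sqrt2sqrt3Points where
  toFun i := ⟨!₂[(VNDL10.pt i).1, (VNDL10.pt i).2], fun j => by
    fin_cases j
    · exact (l10_pt_mem i).1
    · exact (l10_pt_mem i).2⟩
  map_rel' := by
    intro i j hij
    have hsq : VNDL10.sqDist (VNDL10.pt i) (VNDL10.pt j) = 1 := VNDL10.adj_sqDist_eq_one hij
    change dist (!₂[(VNDL10.pt i).1, (VNDL10.pt i).2] : EuclideanSpace ℝ (Fin 2))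
      !₂[(VNDL10.pt j).1, (VNDL10.pt j).2] = 1
    have hd : dist (!₂[(VNDL10.pt i).1, (VNDL10.pt i).2] : EuclideanSpace ℝ (Fin 2))
        !₂[(VNDL10.pt j).1, (VNDL10.pt j).2] ^ 2 = 1 := by
      rw [EuclideanSpace.dist_sq_eq, Fin.sum_univ_two, Real.dist_eq, Real.dist_eq, sq_abs, sq_abs]
      simpa [VNDL10.sqDist] using hsq
    exact (pow_eq_one_iff_of_nonneg dist_nonneg two_ne_zero).1 hd

/-- THEOREM U4 (plane form): the chromatic number of the Euclidean unit-distance graph restricted to `ℚ(√2,√3)²`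
is exactly `4`. -/
theorem chromaticNumber_plane_sqrt2sqrt3 :
    (planeUnitDistanceGraph.induce sqrt2sqrt3Points).chromaticNumber = 4 := by
  rw [show (4 : ℕ∞) = (3 : ℕ) + 1 by norm_num]
  refine chromaticNumber_eq_iff_colorable_not_colorable.mpr
    ⟨?_, fun h => VNDL10.not_colorable_three (h.of_hom l10HomPlane)⟩
  exact colorable_four_of_realisation_in_sqrt2sqrt3Field (G := planeUnitDistanceGraph.induce sqrt2sqrt3Points)
    (p := fun q => (q : EuclideanSpace ℝ (Fin 2)))
    ⟨Subtype.coe_injective, fun _ _ h => h⟩ (fun q i => q.2 i)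

end Summit.Ventures.DiscreteObjects.UnitDistance
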